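import Literature.MathematicalPhysics.QuantumFieldTheory.Balaban1983to89.T4ShellMeasureAnalytic

/-!
# `Balaban1983to89.T4ShellMeasurePlaquette` — node U5b, cell input NE7c, SHELL-MEASURE ROUTE: the BOND → PLAQUETTE
analytic importer for member (γ″)'s binder (AN-bound), in kernel

(cell `pub-balaban`, T4-DAG v23 §6 row NE7c, fan-out seat `b2b-balaban-t4-ne7c-p1` gen 9, design row
T4-U5b.E2-NE7c-PROVE-P1j*; Mathlib + `T4ShellMeasureAnalytic` only; companion record `t4/T4-EST-NE7c-P1.md` §3 (γ″),
GAPS G-ne7cp1-8a ((AN-bound)) with the B11-side producer reading GAPS C-B11-G23a (lineage `b2b-balaban-b11`, gen 23); v1.)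

WHAT THIS LEAF IS FOR.  Member (γ″) of the shell-measure route (`T4ShellMeasureAnalytic.fibreAlternative_of_analytic_family`,
v2/v3) takes, per dilation fibre and per live plaquette `p`, a PLAQUETTE FUNCTIONAL `f p : ℂ → F` — the deviation
`U(∂p) − 1` of the plaquette variable of the continued configuration along the complexified dilation ray `z` — with three
binders: `f p` complex differentiable on `‖z‖ < R`, `‖f p z‖ ≤ H` there, `f p 0 = 0` (the flat point).  The pair `(R, H)`,
uniform in the level `k`, is the located input (AN-bound) (GAPS G-ne7cp1-8a): it is NOT displayed in print for plaquette
functionals.  What print offers (B11 = Bałaban, CMP 102 (1985), Sect. G, Proposition 9 with (19), (25), (173), (177) — READ,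
not instantiated, in GAPS C-B11-G23a) is of BOND type: the Landau-gauge field `𝓗(B)` of the small configuration is an
analytic function of the complexified datum, its bond values are bounded ((19), `n = 0`), its lattice curl — the
linearised plaquette variable, (25) — is bounded by the `n = 1` clause of (19), and `𝓗(0) = 0` ((177)).  THIS LEAF is the
[folklore] normed-algebra step from the bond type to the plaquette type, so that AFTER it the located binder (AN-bound) reads
«B11 Prop. 9's printed-type bounds for the BOND variables at the relevant background, uniform in `k`» instead of an
undisplayed plaquette pair `(R, H)`:

 * if the oriented bond variables `X₁, …, X_ℓ : ℂ → A` of `∂p` along the ray (values in a complete normed `ℂ`-algebra `A`,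
   e.g. `M_N(ℂ)` with the Hilbert–Schmidt norm) are complex differentiable on a set, so is the plaquette functional
   `f_p(z) = exp X₁(z) ⋯ exp X_ℓ(z) − 1` (`differentiableOn_plaquetteFn`; Mathlib's `NormedSpace.exp_analytic`);
 * `X_i(0) = 0` for all `i` gives `f_p(0) = 0` (`plaquetteFn_apply_zero`);
 * THE BOUND (`norm_plaquetteFn_le`): in any complete normed algebra, for any finite list,
   `‖exp Y₁ ⋯ exp Y_ℓ − 1‖ ≤ ‖Y₁ + ⋯ + Y_ℓ‖ + (e^{Σ‖Y_i‖} − 1 − Σ‖Y_i‖)`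
   (`norm_listProd_exp_sub_one_le_norm_sum`: induction on the list with the exact identities
   `e·P − 1 − (Y + S) = (e − 1)(P − 1) + (e − 1 − Y) + (P − 1 − S)` and
   `(eʸ − 1)(e^σ − 1) + (eʸ − 1 − y) + (e^σ − 1 − σ) = e^{y+σ} − 1 − (y + σ)`; no commutativity, no `‖1‖ = 1`), hence with
   `‖X_i(z)‖ ≤ a` and `‖Σ X_i(z)‖ ≤ s₁`:  `‖f_p(z)‖ ≤ s₁ + (e^{ℓa} − 1 − ℓa) ≤ s₁ + (ℓa)²` (`ℓa ≤ 1`), and in B11's regime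
   `ℓ ≤ 4`, `a ≤ 1/32` ((32): `32ε₂ ≤ 1`):  `‖f_p(z)‖ ≤ s₁ + 9a² ≤ s₁ + 11a²` (`norm_plaquetteFn_le_four`) — the shape of
   C-B11-G23a's inheritance step `‖g₁g₂g₃g₄ − 1‖ ≤ ‖ΣX_i‖ + ((1 + a + a²)⁴ − 1 − 4a) ≤ ‖ΣX_i‖ + 11a²`, whose 4-fold model was
   kernel-checked in the b11 lineage's scratch `PlaquetteInherit.scratch.lean` (sha256[:16] 34e14f3d0c8afffb); the list
   form and the exponential remainder here are this leaf's own [folklore] proofs;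
 * WIRING (`fibreAlternative_of_bondAnalytic_family`, `…_four`): `T4ShellMeasureAnalytic.fibreAlternative_of_analytic_family`
   BY NAME with `f p := ι ∘ f_p` for a `ℂ`-linear isometry `ι : A →ₗᵢ[ℂ] F` into the complete complex inner-product space of
   that leaf (composition keeps differentiability, norms and the zero; the norm profile is unchanged,
   `normProfile_comp_linearIsometry`) and `H := s₁ + 11a²` (resp. any `H ≥ s₁ + (e^{ℓa} − 1 − ℓa)`); every other hypothesis
   ((SM) with `cauchyCoef H R x₀ = 9H/(R − x₀)²`, (DC-fwd), the tail conventions) is passed through verbatim.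

DICTIONARY (a READING, GAPS C-B11-G23a, not a citation of authority): at the flat background, `X_i(z) = ±iη·𝓗(zω)(b_i)` for
the four bonds of `∂p`, `a = ε₂L^{−j}` from (19) `n = 0`, `s₁ = ‖ΣX_i‖ = η²‖(∂𝓗)(p)‖ ≤ 2ε₂L^{−2j}` from (25) + (19) `n = 1`,
`R = log(1 + C₁ε̄₁)` from (172) + (22)–(23), whence `H ≤ (2 + 11ε₂)ε₂L^{−2j}` (flat background: the parallel transporters
`R(U₀(·))` of (25) are `1`, so `U₁(∂p)` IS a product of exponentials of the bond values); the printed norms are operator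
norms, while an isometric realisation `ι : A →ₗᵢ[ℂ] F` wants a Hilbertian norm on `A` (Hilbert–Schmidt), at a cost `≤ √N` on
`a`, `s₁` — the instantiator's modelling choice (C-B11-G23a (N)); the uniformity in `k` of these constants («depend on d and
L only») and the choice of background/gauge representative are part of that reading and stay located (G-ne7cp1-8a after
this leaf); (SM) (G-ne7cp1-9) is untouched.

HONEST FRAMING.  Rung (B)+1 only, finite `T⁴`; NOT infinite volume, NOT a mass gap, NOT Clay; NOT summit progress; NE7c stays
COUNTED on the spine.  Nothing of [Bałaban 1983–89] is instantiated: the bond data are BINDERS of the wiring theorem, of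
the printed TYPE; whether the series delivers them uniformly in `k` at the background the good class needs, and the
smallness (SM), (SS′), (DC-fwd), (GOOD′)/(TS), (W1), the (F∞)-rate, BetaPertH/(B)/(B^μ) upstream — all remain explicit
conditionals of the route (GAPS G-ne7cp1-4, -7/7a, -8a, -9, -10/10a/10b, -11, -13/13a).
ABSOLUTE RULE.  No internally-minted statement is a cited fact; every hypothesis is a binder; all docstrings [folklore]; 0 sorry.

CONTENT: §1 exponential remainders of order one and two in a complete normed `ℂ`-algebra (no hypothesis on `‖1‖`);
§2 the non-commutative product remainders for `exp Y₁ ⋯ exp Y_ℓ`; §3 the real tail `expTail₂ t = eᵗ − 1 − t` (monotone,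
`≤ t²` on `|t| ≤ 1`, `≤ (19/36)t²` on `[0, 1/8]`, so `expTail₂ (4a) ≤ 9a²` for `a ≤ 1/32`); §4 the plaquette functional:
differentiability, zero, bounds; §5 the wiring to member (γ″); §6 non-vacuity.

(value: bookkeeping toward (AN-bound) — converts an undisplayed plaquette-level pair `(R, H)` into bond-level binders of
B11 Prop. 9's printed type plus [folklore] algebra; no new estimate about the renormalization flow.  NOT summit progress.)
-/

noncomputable section

open NormedSpace Metric Set

namespace Literature.MathematicalPhysics.QuantumFieldTheory.Balaban1983to89.T4ShellMeasurePlaquette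

open scoped ENNReal
open Literature.MathematicalPhysics.QuantumFieldTheory.Balaban1983to89.T4ShellMeasureAnalytic

/-! ## §1 Exponential remainders in a complete normed `ℂ`-algebra -/

section ExpRemainder

variable {A : Type*} [NormedRing A] [NormedAlgebra ℂ A] [CompleteSpace A]

omit [CompleteSpace A] in
/-- termwise bound for the exponential series with complex coefficients: `‖aⁿ/n!‖ ≤ ‖a‖ⁿ/n!` for `n ≥ 1`
(no hypothesis on `‖1‖`). [folklore] -/
theorem norm_expSeries_term_le (a : A) {n : ℕ} (hn : 0 < n) :
    ‖((n.factorial : ℂ)⁻¹) • a ^ n‖ ≤ ‖a‖ ^ n / n.factorial := by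
  rw [norm_smul, norm_inv, Complex.norm_natCast, div_eq_inv_mul]
  gcongr
  exact norm_pow_le' a hn

/-- FIRST-ORDER REMAINDER: `‖exp a − 1‖ ≤ e^{‖a‖} − 1` in any complete normed `ℂ`-algebra (termwise comparison of
`Σ_{n ≥ 1} aⁿ/n!` with the real series). [folklore] -/
theorem norm_exp_sub_one_le (a : A) : ‖exp a - 1‖ ≤ Real.exp ‖a‖ - 1 := by
  have h1 : HasSum (fun n : ℕ => ((n.factorial : ℂ)⁻¹) • a ^ n) (exp a) :=
    exp_series_hasSum_exp' (𝕂 := ℂ) a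
  have h1' : HasSum (fun n : ℕ => (((n + 1).factorial : ℂ)⁻¹) • a ^ (n + 1)) (exp a - 1) := by
    have h := (hasSum_nat_add_iff' 1).mpr h1
    simpa using h
  have h2 : HasSum (fun n : ℕ => ‖a‖ ^ n / (n.factorial : ℝ)) (Real.exp ‖a‖) := by
    rw [Real.exp_eq_exp_ℝ]
    exact expSeries_div_hasSum_exp ‖a‖
  have h2' : HasSum (fun n : ℕ => ‖a‖ ^ (n + 1) / ((n + 1).factorial : ℝ)) (Real.exp ‖a‖ - 1) := by
    have h := (hasSum_nat_add_iff' 1).mpr h2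
    simpa using h
  exact h1'.norm_le_of_bounded h2' fun n => norm_expSeries_term_le a n.succ_pos

/-- SECOND-ORDER REMAINDER: `‖exp a − 1 − a‖ ≤ e^{‖a‖} − 1 − ‖a‖` in any complete normed `ℂ`-algebra (termwise
comparison of `Σ_{n ≥ 2} aⁿ/n!` with the real series). [folklore] -/
theorem norm_exp_sub_one_sub_le (a : A) : ‖exp a - 1 - a‖ ≤ Real.exp ‖a‖ - 1 - ‖a‖ := by
  have h1 : HasSum (fun n : ℕ => ((n.factorial : ℂ)⁻¹) • a ^ n) (exp a) :=
    exp_series_hasSum_exp' (𝕂 := ℂ) a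
  have h1' : HasSum (fun n : ℕ => (((n + 2).factorial : ℂ)⁻¹) • a ^ (n + 2)) (exp a - 1 - a) := by
    have h := (hasSum_nat_add_iff' 2).mpr h1
    have e : ∑ i ∈ Finset.range 2, ((i.factorial : ℂ)⁻¹) • a ^ i = 1 + a := by
      simp [Finset.sum_range_succ]
    rw [e, ← sub_sub] at h
    exact h
  have h2 : HasSum (fun n : ℕ => ‖a‖ ^ n / (n.factorial : ℝ)) (Real.exp ‖a‖) := by
    rw [Real.exp_eq_exp_ℝ]
    exact expSeries_div_hasSum_exp ‖a‖
  have h2' : HasSum (fun n : ℕ => ‖a‖ ^ (n + 2) / ((n + 2).factorial : ℝ)) (Real.exp ‖a‖ - 1 - ‖a‖) := by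
    have h := (hasSum_nat_add_iff' 2).mpr h2
    have e : ∑ i ∈ Finset.range 2, ‖a‖ ^ i / (i.factorial : ℝ) = 1 + ‖a‖ := by
      simp [Finset.sum_range_succ]
    rw [e, ← sub_sub] at h
    exact h
  exact h1'.norm_le_of_bounded h2' fun n => norm_expSeries_term_le a (Nat.succ_pos _)

end ExpRemainder

/-! ## §2 Non-commutative product remainders for `exp Y₁ ⋯ exp Y_ℓ` -/

section ProductRemainder

variable {A : Type*} [NormedRing A] [NormedAlgebra ℂ A] [CompleteSpace A]

/-- FIRST-ORDER PRODUCT REMAINDER: `‖exp Y₁ ⋯ exp Y_ℓ − 1‖ ≤ e^{Σ‖Y_i‖} − 1` (induction; the identity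
`e·P − 1 = (e − 1)(P − 1) + (e − 1) + (P − 1)` avoids any hypothesis on `‖1‖`). [folklore] -/
theorem norm_listProd_exp_sub_one_le :
    ∀ l : List A, ‖(l.map exp).prod - 1‖ ≤ Real.exp (l.map fun Y => ‖Y‖).sum - 1
  | [] => by simp
  | Y :: l => by
    have ih := norm_listProd_exp_sub_one_le l
    set P := (l.map exp).prod with hP
    set σ := (l.map fun Y => ‖Y‖).sum with hσ
    simp only [List.map_cons, List.prod_cons, List.sum_cons, ← hP, ← hσ]
    have key : exp Y * P - 1 = (exp Y - 1) * (P - 1) + (exp Y - 1) + (P - 1) := by noncomm_ring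
    have hY := norm_exp_sub_one_le Y
    have hY0 : 0 ≤ Real.exp ‖Y‖ - 1 := sub_nonneg.2 (Real.one_le_exp (norm_nonneg _))
    rw [key]
    calc ‖(exp Y - 1) * (P - 1) + (exp Y - 1) + (P - 1)‖
        ≤ ‖(exp Y - 1) * (P - 1)‖ + ‖exp Y - 1‖ + ‖P - 1‖ := norm_add₃_le
      _ ≤ ‖exp Y - 1‖ * ‖P - 1‖ + ‖exp Y - 1‖ + ‖P - 1‖ := by gcongr; exact norm_mul_le _ _
      _ ≤ (Real.exp ‖Y‖ - 1) * (Real.exp σ - 1) + (Real.exp ‖Y‖ - 1) + (Real.exp σ - 1) :=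
          add_le_add_three (mul_le_mul hY ih (norm_nonneg _) hY0) hY ih
      _ = Real.exp (‖Y‖ + σ) - 1 := by rw [Real.exp_add]; ring

/-- SECOND-ORDER PRODUCT REMAINDER: `‖exp Y₁ ⋯ exp Y_ℓ − 1 − (Y₁ + ⋯ + Y_ℓ)‖ ≤ e^{Σ‖Y_i‖} − 1 − Σ‖Y_i‖`
(induction; `e·P − 1 − (Y + S) = (e − 1)(P − 1) + (e − 1 − Y) + (P − 1 − S)` and
`(eʸ − 1)(e^σ − 1) + (eʸ − 1 − y) + (e^σ − 1 − σ) = e^{y+σ} − 1 − (y + σ)` exactly). [folklore] -/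
theorem norm_listProd_exp_sub_one_sub_sum_le :
    ∀ l : List A, ‖(l.map exp).prod - 1 - l.sum‖ ≤
      Real.exp (l.map fun Y => ‖Y‖).sum - 1 - (l.map fun Y => ‖Y‖).sum
  | [] => by simp
  | Y :: l => by
    have ih := norm_listProd_exp_sub_one_sub_sum_le l
    have ih₁ := norm_listProd_exp_sub_one_le l
    set P := (l.map exp).prod with hP
    set σ := (l.map fun Y => ‖Y‖).sum with hσ
    simp only [List.map_cons, List.prod_cons, List.sum_cons, ← hP, ← hσ]
    have key : exp Y * P - 1 - (Y + l.sum) = (exp Y - 1) * (P - 1) + (exp Y - 1 - Y) + (P - 1 - l.sum) := by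
      noncomm_ring
    have hY := norm_exp_sub_one_le Y
    have hY₂ := norm_exp_sub_one_sub_le Y
    have hY0 : 0 ≤ Real.exp ‖Y‖ - 1 := sub_nonneg.2 (Real.one_le_exp (norm_nonneg _))
    rw [key]
    calc ‖(exp Y - 1) * (P - 1) + (exp Y - 1 - Y) + (P - 1 - l.sum)‖
        ≤ ‖(exp Y - 1) * (P - 1)‖ + ‖exp Y - 1 - Y‖ + ‖P - 1 - l.sum‖ := norm_add₃_le
      _ ≤ ‖exp Y - 1‖ * ‖P - 1‖ + ‖exp Y - 1 - Y‖ + ‖P - 1 - l.sum‖ := by gcongr; exact norm_mul_le _ _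
      _ ≤ (Real.exp ‖Y‖ - 1) * (Real.exp σ - 1) + (Real.exp ‖Y‖ - 1 - ‖Y‖) + (Real.exp σ - 1 - σ) :=
          add_le_add_three (mul_le_mul hY ih₁ (norm_nonneg _) hY0) hY₂ ih
      _ = Real.exp (‖Y‖ + σ) - 1 - (‖Y‖ + σ) := by rw [Real.exp_add]; ring

/-- **THE PLAQUETTE INHERITANCE INEQUALITY** (general list form, non-commutative):
`‖exp Y₁ ⋯ exp Y_ℓ − 1‖ ≤ ‖Y₁ + ⋯ + Y_ℓ‖ + (e^{Σ‖Y_i‖} − 1 − Σ‖Y_i‖)` — the linear term is kept as a NORM OF THE SUM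
(the linearised plaquette variable), only the genuinely nonlinear part is paid in `Σ‖Y_i‖`. [folklore] -/
theorem norm_listProd_exp_sub_one_le_norm_sum (l : List A) :
    ‖(l.map exp).prod - 1‖ ≤ ‖l.sum‖ + (Real.exp (l.map fun Y => ‖Y‖).sum - 1 - (l.map fun Y => ‖Y‖).sum) := by
  have h := norm_listProd_exp_sub_one_sub_sum_le l
  calc ‖(l.map exp).prod - 1‖ = ‖l.sum + ((l.map exp).prod - 1 - l.sum)‖ := by congr 1; abel
    _ ≤ ‖l.sum‖ + ‖(l.map exp).prod - 1 - l.sum‖ := norm_add_le _ _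
    _ ≤ _ := by gcongr

end ProductRemainder

/-! ## §3 The real tail `eᵗ − 1 − t` -/

section Tail

/-- the second-order exponential tail `expTail₂ t = eᵗ − 1 − t`. [folklore] -/
def expTail₂ (t : ℝ) : ℝ := Real.exp t - 1 - t

/-- `expTail₂ t ≥ 0`. [folklore] -/
theorem expTail₂_nonneg (t : ℝ) : 0 ≤ expTail₂ t := by
  have := Real.add_one_le_exp t
  unfold expTail₂; linarith

/-- `expTail₂` is non-decreasing on `[0, ∞)`. [folklore] -/
theorem expTail₂_mono {t t' : ℝ} (ht : 0 ≤ t) (htt' : t ≤ t') : expTail₂ t ≤ expTail₂ t' := by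
  unfold expTail₂
  have h1 : 1 ≤ Real.exp t := Real.one_le_exp ht
  have hd : t' - t + 1 ≤ Real.exp (t' - t) := Real.add_one_le_exp _
  have he : Real.exp t' = Real.exp t * Real.exp (t' - t) := by rw [← Real.exp_add]; ring_nf
  rw [he]
  nlinarith [mul_nonneg (sub_nonneg.2 h1) (by linarith : (0 : ℝ) ≤ Real.exp (t' - t) - 1)]

/-- `expTail₂ t ≤ t²` for `|t| ≤ 1` (Mathlib `Real.abs_exp_sub_one_sub_id_le`). [folklore] -/
theorem expTail₂_le_sq {t : ℝ} (ht : |t| ≤ 1) : expTail₂ t ≤ t ^ 2 :=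
  (le_abs_self _).trans (Real.abs_exp_sub_one_sub_id_le ht)

/-- the sharper tail on `[0, 1/8]`: `expTail₂ t ≤ (19/36) t²` (third-order Taylor bound `eᵗ ≤ 1 + t + t²/2 + (2/9)t³`,
Mathlib `Real.exp_bound'` with `n = 3`, and `t ≤ 1/8`). [folklore] -/
theorem expTail₂_le_of_le_eighth {t : ℝ} (h0 : 0 ≤ t) (h8 : t ≤ 1 / 8) : expTail₂ t ≤ 19 / 36 * t ^ 2 := by
  have h := Real.exp_bound' h0 (by linarith) (n := 3) (by norm_num)
  have e : (∑ m ∈ Finset.range 3, t ^ m / (m.factorial : ℝ)) = 1 + t + t ^ 2 / 2 := by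
    simp [Finset.sum_range_succ, Nat.factorial]
  rw [e] at h
  norm_num [Nat.factorial] at h
  unfold expTail₂
  nlinarith [sq_nonneg t, mul_nonneg h0 (sq_nonneg t)]

/-- B11's regime ((32): `32ε₂ ≤ 1`): for `0 ≤ a ≤ 1/32`, `e^{4a} − 1 − 4a ≤ 9a²` (indeed `≤ (76/9)a²`). [folklore] -/
theorem expTail₂_four_mul_le {a : ℝ} (h0 : 0 ≤ a) (h32 : a ≤ 1 / 32) : expTail₂ (4 * a) ≤ 9 * a ^ 2 := by
  have h := expTail₂_le_of_le_eighth (t := 4 * a) (by linarith) (by linarith)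
  nlinarith [sq_nonneg a]

end Tail

/-! ## §4 The plaquette functional of a list of bond variables -/

section Plaquette

variable {A : Type*} [NormedRing A] [NormedAlgebra ℂ A] [CompleteSpace A]

/-- THE PLAQUETTE FUNCTIONAL along a complex ray: for the ORIENTED bond variables `X₁, …, X_ℓ : ℂ → A` of `∂p`
(sign / orientation already inside `X_i`), `plaquetteFn Xs z = exp X₁(z) ⋯ exp X_ℓ(z) − 1`. [folklore] -/
def plaquetteFn (Xs : List (ℂ → A)) (z : ℂ) : A := (Xs.map fun X => exp (X z)).prod - 1

omit [NormedAlgebra ℂ A] [CompleteSpace A] in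
/-- unfolding: the product is over the list of bond VALUES at `z`. [folklore] -/
theorem plaquetteFn_eq (Xs : List (ℂ → A)) (z : ℂ) :
    plaquetteFn Xs z = ((Xs.map fun X => X z).map exp).prod - 1 := by
  simp [plaquetteFn, List.map_map, Function.comp_def]

omit [NormedAlgebra ℂ A] [CompleteSpace A] in
/-- AT THE FLAT POINT: if every bond variable vanishes at `z = 0` then `plaquetteFn Xs 0 = 0`. [folklore] -/
theorem plaquetteFn_apply_zero {Xs : List (ℂ → A)} (h0 : ∀ X ∈ Xs, X 0 = 0) : plaquetteFn Xs 0 = 0 := by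
  unfold plaquetteFn
  rw [List.prod_eq_one, sub_self]
  intro x hx
  obtain ⟨X, hX, rfl⟩ := List.mem_map.1 hx
  rw [h0 X hX, exp_zero]

/-- the product `z ↦ exp X₁(z) ⋯ exp X_ℓ(z)` is complex differentiable where the bond variables are
(Mathlib `NormedSpace.exp_analytic` composed, and the product rule in a normed algebra). [folklore] -/
theorem differentiableOn_listProd_exp {s : Set ℂ} :
    ∀ Xs : List (ℂ → A), (∀ X ∈ Xs, DifferentiableOn ℂ X s) →
      DifferentiableOn ℂ (fun z => (Xs.map fun X => exp (X z)).prod) s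
  | [], _ => by simp
  | X :: Xs, h => by
    have hX : DifferentiableOn ℂ X s := h X (by simp)
    have hexp : DifferentiableOn ℂ (fun z => exp (X z)) s := fun z hz =>
      ((exp_analytic (𝕂 := ℂ) (X z)).differentiableAt).comp_differentiableWithinAt z (hX z hz)
    have ih := differentiableOn_listProd_exp Xs fun Y hY => h Y (List.mem_cons_of_mem _ hY)
    simp only [List.map_cons, List.prod_cons]
    exact hexp.mul ih

/-- ANALYTICITY OF THE PLAQUETTE FUNCTIONAL: `plaquetteFn Xs` is complex differentiable on any set on which every bond
variable is. [folklore] -/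
theorem differentiableOn_plaquetteFn {Xs : List (ℂ → A)} {s : Set ℂ} (h : ∀ X ∈ Xs, DifferentiableOn ℂ X s) :
    DifferentiableOn ℂ (plaquetteFn Xs) s :=
  (differentiableOn_listProd_exp Xs h).sub_const 1

/-- THE BOUND, sharp form: `‖plaquetteFn Xs z‖ ≤ ‖Σ_i X_i(z)‖ + expTail₂ (Σ_i ‖X_i(z)‖)`. [folklore] -/
theorem norm_plaquetteFn_le (Xs : List (ℂ → A)) (z : ℂ) :
    ‖plaquetteFn Xs z‖ ≤ ‖(Xs.map fun X => X z).sum‖ + expTail₂ ((Xs.map fun X => ‖X z‖).sum) := by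
  have h := norm_listProd_exp_sub_one_le_norm_sum (Xs.map fun X => X z)
  rw [plaquetteFn_eq, expTail₂]
  simpa [List.map_map, Function.comp_def] using h

omit [NormedAlgebra ℂ A] [CompleteSpace A] in
/-- bookkeeping: under a uniform bond bound `‖X_i(z)‖ ≤ a` the sum of norms is `≤ (length) · a` and `≥ 0`. [folklore] -/
theorem sum_norm_le_length_mul {Xs : List (ℂ → A)} {z : ℂ} {a : ℝ} (ha : ∀ X ∈ Xs, ‖X z‖ ≤ a) :
    0 ≤ (Xs.map fun X => ‖X z‖).sum ∧ (Xs.map fun X => ‖X z‖).sum ≤ Xs.length * a := by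
  refine ⟨List.sum_nonneg (by intro x hx; obtain ⟨X, -, rfl⟩ := List.mem_map.1 hx; exact norm_nonneg _), ?_⟩
  have h := List.sum_le_card_nsmul (Xs.map fun X => ‖X z‖) a
    (by intro x hx; obtain ⟨X, hX, rfl⟩ := List.mem_map.1 hx; exact ha X hX)
  simpa [nsmul_eq_mul] using h

/-- THE BOUND under UNIFORM bond data: `‖X_i(z)‖ ≤ a` for all `i` and `‖Σ_i X_i(z)‖ ≤ s₁` give
`‖plaquetteFn Xs z‖ ≤ s₁ + expTail₂ (ℓ·a)` for any `ℓ ≥ length`. [folklore] -/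
theorem norm_plaquetteFn_le_of_uniform {Xs : List (ℂ → A)} {z : ℂ} {a s₁ : ℝ} {ℓ : ℕ}
    (ha : ∀ X ∈ Xs, ‖X z‖ ≤ a) (hs : ‖(Xs.map fun X => X z).sum‖ ≤ s₁) (ha0 : 0 ≤ a) (hℓ : Xs.length ≤ ℓ) :
    ‖plaquetteFn Xs z‖ ≤ s₁ + expTail₂ (ℓ * a) := by
  obtain ⟨h0, hle⟩ := sum_norm_le_length_mul ha
  have hle' : (Xs.map fun X => ‖X z‖).sum ≤ ℓ * a :=
    hle.trans (mul_le_mul_of_nonneg_right (by exact_mod_cast hℓ) ha0)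
  exact (norm_plaquetteFn_le Xs z).trans (add_le_add hs (expTail₂_mono h0 hle'))

/-- quadratic form: with `ℓ·a ≤ 1`, `‖plaquetteFn Xs z‖ ≤ s₁ + (ℓa)²`. [folklore] -/
theorem norm_plaquetteFn_le_sq {Xs : List (ℂ → A)} {z : ℂ} {a s₁ : ℝ} {ℓ : ℕ}
    (ha : ∀ X ∈ Xs, ‖X z‖ ≤ a) (hs : ‖(Xs.map fun X => X z).sum‖ ≤ s₁) (ha0 : 0 ≤ a) (hℓ : Xs.length ≤ ℓ)
    (hℓa : ℓ * a ≤ 1) : ‖plaquetteFn Xs z‖ ≤ s₁ + (ℓ * a) ^ 2 := by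
  refine (norm_plaquetteFn_le_of_uniform ha hs ha0 hℓ).trans (add_le_add le_rfl (expTail₂_le_sq ?_))
  rw [abs_of_nonneg (by positivity)]
  exact hℓa

/-- **B11's PLAQUETTE REGIME** (at most four bonds, `a ≤ 1/32`): `‖plaquetteFn Xs z‖ ≤ s₁ + 11a²` (the kernel gives
`s₁ + 9a²`; `11a²` is the constant of the producer reading C-B11-G23a, kept so that its arithmetic
`H ≤ (2 + 11ε₂)ε₂L^{−2j}` applies verbatim). [folklore] -/
theorem norm_plaquetteFn_le_four {Xs : List (ℂ → A)} {z : ℂ} {a s₁ : ℝ}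
    (ha : ∀ X ∈ Xs, ‖X z‖ ≤ a) (hs : ‖(Xs.map fun X => X z).sum‖ ≤ s₁) (ha0 : 0 ≤ a) (h32 : a ≤ 1 / 32)
    (h4 : Xs.length ≤ 4) : ‖plaquetteFn Xs z‖ ≤ s₁ + 11 * a ^ 2 := by
  have h := norm_plaquetteFn_le_of_uniform ha hs ha0 h4
  have ht : expTail₂ ((4 : ℕ) * a) ≤ 9 * a ^ 2 := by
    simpa using expTail₂_four_mul_le ha0 h32
  nlinarith [sq_nonneg a]

end Plaquette

/-! ## §5 Wiring to member (γ″): `fibreAlternative_of_analytic_family` from BOND data -/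

section Wiring

variable {A : Type*} [NormedRing A] [NormedAlgebra ℂ A] [CompleteSpace A]
variable {F : Type*} [NormedAddCommGroup F] [InnerProductSpace ℂ F] [CompleteSpace F]

omit [CompleteSpace A] [CompleteSpace F] in
/-- a linear isometry does not change the norm profile. [folklore] -/
theorem normProfile_comp_linearIsometry (ι : A →ₗᵢ[ℂ] F) (g : ℝ → A) (r₀ r : ℝ) :
    normProfile (fun t => ι (g t)) r₀ r = normProfile g r₀ r := by
  simp [normProfile]

/-- **MEMBER (γ″) FROM BOND-TYPE ANALYTIC DATA** — `T4ShellMeasureAnalytic.fibreAlternative_of_analytic_family` with its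
plaquette binders `hf`/`hH`/`hf0` DISCHARGED from bond binders of B11 Prop. 9's printed type: per direction `p ∈ P` a list
`Xs p` of oriented bond variables `ℂ → A` (a complete normed `ℂ`-algebra realised isometrically inside the complete complex
inner-product space `F` by `ι`), each complex differentiable on `‖z‖ < R`, vanishing at `0`, bounded by `a ≥ 0` there, with
the linearised plaquette variable bounded `‖Σ_i X_i(z)‖ ≤ s₁`, at most `ℓ` bonds, and ANY majorant
`H ≥ s₁ + expTail₂ (ℓ a)`; the tested profile is that of `plaquetteFn (Xs p)` itself; (SM), (DC-fwd) and the tail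
conventions are passed verbatim. [folklore] -/
theorem fibreAlternative_of_bondAnalytic_family {Y ι' : Type*} {Fd : Y × ℝ → ℝ≥0∞} {u : Y × ℝ → ℝ}
    {P : Finset ι'} (hP : P.Nonempty) (Xs : ι' → List (ℂ → A)) (ι : A →ₗᵢ[ℂ] F)
    {R H a s₁ r₀ s θ ρ B σ L : ℝ} {ℓ : ℕ} (y : Y)
    (hR : Real.exp (-r₀) < R)
    (hX : ∀ p ∈ P, ∀ X ∈ Xs p, DifferentiableOn ℂ X (ball 0 R))
    (hXa : ∀ p ∈ P, ∀ X ∈ Xs p, ∀ z ∈ ball (0 : ℂ) R, ‖X z‖ ≤ a) (ha0 : 0 ≤ a)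
    (hX0 : ∀ p ∈ P, ∀ X ∈ Xs p, X 0 = 0)
    (hXs : ∀ p ∈ P, ∀ z ∈ ball (0 : ℂ) R, ‖((Xs p).map fun X => X z).sum‖ ≤ s₁)
    (hℓ : ∀ p ∈ P, (Xs p).length ≤ ℓ) (hH : s₁ + expTail₂ (ℓ * a) ≤ H)
    (hs0 : 0 ≤ s) (hs : s < 1 / 2) (hθ : 0 < θ) (hρ1 : ρ < 1)
    (hSM : (cauchyCoef H R (Real.exp (-r₀)) + cauchyCoef H R (Real.exp (-r₀))) * Real.exp (-r₀) ^ 2 ≤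
      s * (θ * (1 - ρ)))
    (hu : ∀ r, u (y, r) = P.sup' hP fun p => normProfile (fun t : ℝ => plaquetteFn (Xs p) t) r₀ r)
    (hF0 : ∀ r, r < r₀ → Fd (y, r) = 0) (hFwd : FwdLogLipschitzOn (fun r => Fd (y, r)) B (Ici r₀)) :
    FibreAlternative Fd u (s / (1 - 2 * s)) σ B θ ρ L y := by
  refine fibreAlternative_of_analytic_family hP y hR (f := fun p z => ι (plaquetteFn (Xs p) z)) (H := H)
    ?_ ?_ ?_ hs0 hs hθ hρ1 hSM ?_ hF0 hFwd
  · intro p hp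
    exact ι.toContinuousLinearMap.differentiable.comp_differentiableOn (differentiableOn_plaquetteFn (hX p hp))
  · intro p hp z hz
    rw [ι.norm_map]
    exact (norm_plaquetteFn_le_of_uniform (fun X hX' => hXa p hp X hX' z hz) (hXs p hp z hz) ha0 (hℓ p hp)).trans hH
  · intro p hp
    simp [plaquetteFn_apply_zero (hX0 p hp)]
  · intro r
    rw [hu r]
    congr 1
    funext p
    exact (normProfile_comp_linearIsometry ι (fun t : ℝ => plaquetteFn (Xs p) t) r₀ r).symm

/-- **MEMBER (γ″) IN B11's PLAQUETTE REGIME** — the preceding with at most four bonds per plaquette and `a ≤ 1/32`, the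
majorant being `H := s₁ + 11a²` (so, with the reading `a = ε₂L^{−j}`, `s₁ = 2ε₂L^{−2j}` of C-B11-G23a,
`H = (2 + 11ε₂)ε₂L^{−2j}`). [folklore] -/
theorem fibreAlternative_of_bondAnalytic_family_four {Y ι' : Type*} {Fd : Y × ℝ → ℝ≥0∞} {u : Y × ℝ → ℝ}
    {P : Finset ι'} (hP : P.Nonempty) (Xs : ι' → List (ℂ → A)) (ι : A →ₗᵢ[ℂ] F)
    {R a s₁ r₀ s θ ρ B σ L : ℝ} (y : Y)
    (hR : Real.exp (-r₀) < R)
    (hX : ∀ p ∈ P, ∀ X ∈ Xs p, DifferentiableOn ℂ X (ball 0 R))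
    (hXa : ∀ p ∈ P, ∀ X ∈ Xs p, ∀ z ∈ ball (0 : ℂ) R, ‖X z‖ ≤ a) (ha0 : 0 ≤ a) (h32 : a ≤ 1 / 32)
    (hX0 : ∀ p ∈ P, ∀ X ∈ Xs p, X 0 = 0)
    (hXs : ∀ p ∈ P, ∀ z ∈ ball (0 : ℂ) R, ‖((Xs p).map fun X => X z).sum‖ ≤ s₁)
    (h4 : ∀ p ∈ P, (Xs p).length ≤ 4)
    (hs0 : 0 ≤ s) (hs : s < 1 / 2) (hθ : 0 < θ) (hρ1 : ρ < 1)
    (hSM : (cauchyCoef (s₁ + 11 * a ^ 2) R (Real.exp (-r₀)) + cauchyCoef (s₁ + 11 * a ^ 2) R (Real.exp (-r₀))) *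
      Real.exp (-r₀) ^ 2 ≤ s * (θ * (1 - ρ)))
    (hu : ∀ r, u (y, r) = P.sup' hP fun p => normProfile (fun t : ℝ => plaquetteFn (Xs p) t) r₀ r)
    (hF0 : ∀ r, r < r₀ → Fd (y, r) = 0) (hFwd : FwdLogLipschitzOn (fun r => Fd (y, r)) B (Ici r₀)) :
    FibreAlternative Fd u (s / (1 - 2 * s)) σ B θ ρ L y := by
  refine fibreAlternative_of_bondAnalytic_family hP Xs ι y hR hX hXa ha0 hX0 hXs h4 (ℓ := 4) ?_ hs0 hs hθ hρ1 hSM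
    hu hF0 hFwd
  have ht : expTail₂ ((4 : ℕ) * a) ≤ 9 * a ^ 2 := by simpa using expTail₂_four_mul_le ha0 h32
  nlinarith [sq_nonneg a]

end Wiring

/-! ## §6 Non-vacuity -/

section NonVacuity

/-- INSTANCE (`A = ℂ`, two opposite bonds `z ↦ z·c`, `z ↦ −z·c`): the plaquette functional vanishes at the flat point
and is entire. [folklore] -/
example (c : ℂ) : plaquetteFn [fun z : ℂ => z * c, fun z : ℂ => -(z * c)] 0 = 0 :=
  plaquetteFn_apply_zero (by intro X hX; simp at hX; rcases hX with rfl | rfl <;> simp)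

/-- the same instance is complex differentiable everywhere. [folklore] -/
example (c : ℂ) : DifferentiableOn ℂ (plaquetteFn [fun z : ℂ => z * c, fun z : ℂ => -(z * c)]) univ :=
  differentiableOn_plaquetteFn (by
    intro X hX; simp at hX
    rcases hX with rfl | rfl
    · exact (differentiableOn_id.mul_const c)
    · exact (differentiableOn_id.mul_const c).neg)

/-- NUMBERS: in B11's regime the exponential remainder of four bonds of size `1/32` is at most `9/1024 < 11/1024`.
[folklore] -/
example : expTail₂ (4 * (1 / 32)) ≤ 9 * (1 / 32) ^ 2 := expTail₂_four_mul_le (by norm_num) le_rfl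

/-- the arithmetic behind `9`: `(19/36)·16 = 76/9 ≤ 9 ≤ 11`. [folklore] -/
example : (19 / 36 : ℝ) * 16 ≤ 9 ∧ (9 : ℝ) ≤ 11 := by norm_num

/-- INSTANCE of the inheritance inequality in `ℂ` with the empty plaquette: both sides vanish. [folklore] -/
example : ‖(([] : List ℂ).map exp).prod - 1‖ ≤ ‖([] : List ℂ).sum‖ +
    (Real.exp (([] : List ℂ).map fun Y => ‖Y‖).sum - 1 - (([] : List ℂ).map fun Y => ‖Y‖).sum) :=
  norm_listProd_exp_sub_one_le_norm_sum []

end NonVacuity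

end Literature.MathematicalPhysics.QuantumFieldTheory.Balaban1983to89.T4ShellMeasurePlaquette
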